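import Mathlib
import Literature.Probability.RandomPlanarGeometry.FrontierTiltedSAWLaw
import Literature.Probability.LatticeModels.RandomWalkLoopMeasure
import HarnessLib

/-!
# The diagonal dressed SAW family `P_{s,y} ∝ y^{|γ|} e^{sΦ(γ)}` and its score calculus

Topic `Literature/Probability/RandomPlanarGeometry`, next to `SelfAvoidingWalk.lean` and
`FrontierTiltedSAWLaw.lean` (whose `SAW.DomainSAW`, `SAW.law`, `SAW.criticalFugacity = x_c`,
`SAW.tiltedLaw` are used). These are NEW OBJECTS posited for route `SAWDeterminantalDiagonal` of
`Summits/CriticalPhenomena/SAWScalingLimit` (crux `DiagonalUniversality`, idea cards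
`determinantal-square-c0-diagonal`, `universality-line-integral-score-decoupling`), not published
definitions: the one-parameter *neutral diagonal* `u = 2s` of the route's `(s, u)`-square of
determinantal dressings of the self-avoiding walk — the two-sided Kozdron–Lawler `λ`-SAW tilt
`e^{λ m}` [cite: KozdronLawler2007, §6] combined with the Kasteleyn/dimer dressing `pm⋆^{4s}` —
and the exponential-family ("fluctuation–response") calculus along it.

## Contents (namespace `Literature.Probability.RandomPlanarGeometry.SAW`)

* `dimerFactor H V` — the componentwise dimer-cover count `pm⋆` of the sub-graph of `H` induced on
  `V` (unmatchable components count `1`; the route's inlined `let pm`, verbatim), `blockArena Ω δ`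
  — the even-block dimer arena `A_δ ⊆ Ω_δ` (the route's `let A`, verbatim), and the **neutral
  dressing exponent** `diagonalDressing γ = Φ(γ) = m(γ) + 4·log pm⋆(A_δ ∖ γ)` of a SAW `γ` of `Ω_δ`
  (`m = rwLoopMass`, the route's `let m`);
* the **diagonal family** `diagonalLaw Ω δ a b s y = P_{s,y} ∝ y^{|γ|} e^{sΦ(γ)}` on
  `SAW.DomainSAW Ω δ a b` (`= SAW.tiltedLaw B s y` with `B = e^{Φ}`), its real weight
  `diagonalWeight s y γ = y^{|γ|} e^{sΦ(γ)}`; **`(s, y) = (0, x_c)` is the critical SAW law**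
  (`diagonalLaw_zero_criticalFugacity`, PROVED, from `tiltedLaw_zero_criticalFugacity`) and
  **`s = 1/2` is the route's discrepancy walk** `∝ y^{|γ|} e^{m/2} pm⋆²`
  (`diagonalLaw_half_eq_discrepancyLaw`, PROVED);
* the **score** `diagonalScore ξ s γ = Φ(γ) + (ξ'(s)/ξ(s))·|γ| = ∂_s log (ξ(s)^{|γ|} e^{sΦ(γ)})`
  along a fugacity curve `ξ`;
* the **criticality window** `InDiagonalWindow s y` (in every Dobrushin domain and endpoint
  approximation the `P_{s,y}`-walk is, in probability, neither ballistic nor dense: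
  `P(δ·|γ| ≤ K) → 0`, `P(δ²·|γ| ≥ ε) → 0` as `δ → 0⁺`), **critical curves**
  `IsDiagonalCriticalCurve ξ` (`C¹`, positive,
  `ξ(0) = x_c`, window-critical on `[0, 1/2]`), and the hypothesis
  `DiscrepancyConvergesToSLE x` (the discrepancy walk at fugacity `x` converges to chordal
  SLE_{8/3} in every Dobrushin domain — the antecedent of the route's `DiagonalUniversality`);
* evaluation on the finite walk space (PROVED): `finite_domainSAW`, Gibbs averages
  `gibbsAverage`, `integral_diagonalLaw` (`∫ F dP_{s,y} = ∑ wF / ∑ w`), `covariance_diagonalLaw`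
  (`Cov_{s,y}(F,G) = E[FG] − E[F]E[G]`).

The calculus (`(d/ds) E_{s,ξ(s)}[F] = Cov_s(F, score_s)`, the fundamental theorem of calculus along
a critical curve, and the transfer of convergence to SLE_{8/3} down the diagonal) is problem-side:
`Summits/CriticalPhenomena/SAWScalingLimit/Theorems/SAWDeterminantalDiagonalDiagonalUniversalitySplit.lean`.

## What is NOT claimed (open; these are route items, not facts)

Existence of a critical curve (`∃ ξ, IsDiagonalCriticalCurve ξ`), rigidity of the window at the
discrepancy end (`DiscrepancyConvergesToSLE x → InDiagonalWindow (1/2) y → y = x`), and score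
decoupling (`∫₀^{1/2} |Cov_{s,δ}(f ∘ curve, score_s)| ds → 0`) are the three CRUX ITEMS of the
route's split of `DiagonalUniversality`; nothing here asserts them. No named facts
(`def … : Prop` without parameters) are introduced; everything stated is proved.

## References

* M. J. Kozdron, G. F. Lawler, *The configurational measure on mutually avoiding SLE paths*, in:
  Universality and renormalization, Fields Inst. Commun. 50 (2007), §6 (the `λ`-SAW).
* G. F. Lawler, O. Schramm, W. Werner, *On the scaling limit of planar self-avoiding walk*, Proc.
  Sympos. Pure Math. 72 (2004), §3.1 (phases of the `x`-SAW), §3.4.2.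
* R. Kenyon, *Conformal invariance of loops in the double-dimer model*, Comm. Math. Phys. 326
  (2014), §1 (double-dimer weights `pm(D∖η)²`).
-/

noncomputable section

open MeasureTheory Filter Topology Set
open scoped NNReal ENNReal BoundedContinuousFunction
open Literature.Probability.RandomPlanarGeometry Literature.Probability.LatticeModels

namespace Literature.Probability.RandomPlanarGeometry.SAW

/-! ### The route's inlined lattice objects, named -/

/-- The **componentwise dimer factor** `pm⋆(H, V)`: the product over the connected components of
the sub-graph of `H` induced on `V` of the number of their perfect matchings, an unmatchable
component counting `1` (so the factor is `≥ 1` and never vanishes). The route's `let pm`,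
verbatim. [cite: Kenyon2014, §1] -/
def dimerFactor (H : SimpleGraph (Site 2)) (V : Set (Site 2)) : ℕ :=
  ∏ᶠ C : (H.induce V).ConnectedComponent,
    max 1 (Nat.card {M : ((H.induce V).induce C.supp).Subgraph // M.IsPerfectMatching})

/-- The **even-block dimer arena** `A_δ ⊆ Ω_δ`: the sites whose aligned `2 × 2` block lies in `Ω_δ`
with its four sides. The route's `let A`, verbatim. [cite: Kenyon2014, §1] -/
def blockArena (Ω : Set ℂ) (δ : ℝ) : Set (Site 2) :=
  {x | ∀ y : Site 2, (∀ i, y i - Int.emod (y i) 2 = x i - Int.emod (x i) 2) →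
    y ∈ meshDomain Ω δ ∧ ∀ z : Site 2, (∀ i, z i - Int.emod (z i) 2 = x i - Int.emod (x i) 2) →
      (zdGraph 2).Adj y z → (discreteDomainGraph Ω δ).Adj y z}

variable {Ω : Set ℂ} {δ : ℝ} {a b : Site 2}

/-- The **neutral dressing exponent** `Φ(γ) = m(γ) + 4 · log pm⋆(A_δ ∖ γ)` of a SAW of `Ω_δ`: loop
mass of the random-walk loops of `Ω_δ` meeting the trace (`rwLoopMass`, the route's `let m`) plus
four times the log of the dimer factor of the arena minus the trace. The diagonal `u = 2s` of the
route's `(s, u)`-square is the one-parameter tilt by `e^{sΦ}`. [cite: KozdronLawler2007, §6] -/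
def diagonalDressing (γ : SAW.DomainSAW Ω δ a b) : ℝ :=
  rwLoopMass (discreteDomainGraph Ω δ) {v | v ∈ γ.walk.support} +
    4 * Real.log (dimerFactor (discreteDomainGraph Ω δ)
      (blockArena Ω δ \ {v | v ∈ γ.walk.support}) : ℝ)

/-- The **diagonal weight** `w_{s,y}(γ) = y^{|γ|} · e^{s·Φ(γ)}` (a real number; positive for
`y > 0`). [cite: KozdronLawler2007, §6] -/
def diagonalWeight (s y : ℝ) (γ : SAW.DomainSAW Ω δ a b) : ℝ :=
  y ^ γ.length * Real.exp (s * diagonalDressing γ)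

variable (Ω δ a b) in
/-- The **diagonal family** `P_{s,y} ∝ y^{|γ|} e^{sΦ(γ)}` on the SAWs of `Ω_δ` from `a` to `b`: the
tree's tilted SAW law `SAW.tiltedLaw B s y` with frontier weight `B = e^{Φ}`. Junk value `0` when
there is no SAW (as `SAW.law`). [cite: KozdronLawler2007, §6] -/
def diagonalLaw (s y : ℝ) : Measure (SAW.DomainSAW Ω δ a b) :=
  SAW.tiltedLaw (fun γ => ENNReal.ofReal (Real.exp (diagonalDressing γ))) s y

/-- The **score** of the diagonal family along a fugacity curve `ξ`:
`diagonalScore ξ s (γ) = Φ(γ) + (ξ'(s) / ξ(s)) · |γ| = ∂_s log (ξ(s)^{|γ|} e^{sΦ(γ)})`. [folklore] -/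
def diagonalScore (ξ : ℝ → ℝ) (s : ℝ) (γ : SAW.DomainSAW Ω δ a b) : ℝ :=
  diagonalDressing γ + deriv ξ s / ξ s * γ.length

/-- **Criticality window** of the point `(s, y)` of the diagonal family: in every Dobrushin
domain and for every endpoint approximation the `P_{s,y}`-walk is, in probability, neither
ballistic nor dense — `P_{s,y}(δ·|γ| ≤ K) → 0` for every `K` and `P_{s,y}(δ²·|γ| ≥ ε) → 0` for
every `ε > 0`, as `δ → 0⁺` (at criticality `|γ| ≈ δ^{-4/3}`; sub-critical fugacities are
ballistic, super-critical ones dense). [cite: LawlerSchrammWerner2004SAW, §3.1] -/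
def InDiagonalWindow (s y : ℝ) : Prop :=
  ∀ (D : DobrushinDomain) (a b : ℝ → Site 2), SAW.IsEndpointApprox D a b →
    (∀ K : ℝ, Tendsto (fun δ => diagonalLaw D.carrier δ (a δ) (b δ) s y
        {γ | δ * (γ.length : ℝ) ≤ K}) (𝓝[>] (0 : ℝ)) (𝓝 0)) ∧
      ∀ ε : ℝ, 0 < ε → Tendsto (fun δ => diagonalLaw D.carrier δ (a δ) (b δ) s y
        {γ | ε ≤ δ ^ 2 * (γ.length : ℝ)}) (𝓝[>] (0 : ℝ)) (𝓝 0)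

/-- A **critical curve** of the diagonal family: a `C¹` positive fugacity curve `ξ` with
`ξ(0) = x_c` (the SAW end) which is window-critical for every `s ∈ [0, 1/2]`. [folklore] -/
structure IsDiagonalCriticalCurve (ξ : ℝ → ℝ) : Prop where
  /-- `ξ` is continuously differentiable -/
  contDiff : ContDiff ℝ 1 ξ
  /-- `ξ > 0` -/
  pos : ∀ s, 0 < ξ s
  /-- the `s = 0` end is the critical SAW fugacity `x_c = 1/μ` -/
  zero : ξ 0 = SAW.criticalFugacity
  /-- `(s, ξ(s))` is window-critical along `[0, 1/2]` -/
  window : ∀ s ∈ Icc (0 : ℝ) (1 / 2), InDiagonalWindow s (ξ s)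

/-- **The discrepancy walk at fugacity `x` converges to chordal SLE_{8/3}** in every Dobrushin
domain and for every endpoint approximation: the hypothesis `(DW)` of `DiagonalUniversality`, with
the discrepancy law written as the `s = 1/2` member of the diagonal family
(`diagonalLaw_half_eq_discrepancyLaw`). [cite: LawlerSchrammWerner2004SAW, §3.4.2] -/
def DiscrepancyConvergesToSLE (x : ℝ) : Prop :=
  ∀ (D : DobrushinDomain) (a b : ℝ → Site 2), SAW.IsEndpointApprox D a b →
    ConvergesInLawToSLE ((8 : ℝ≥0) / 3) D
      (fun δ (γ : SAW.DomainSAW D.carrier δ (a δ) (b δ)) => γ.curve)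
      (fun δ => diagonalLaw D.carrier δ (a δ) (b δ) (1 / 2) x)

/-! ### Endpoint identifications -/

/-- **`s = 0`, `y = x_c` is the critical SAW law**, whatever the dressing
(`SAW.tiltedLaw_zero_criticalFugacity`). [folklore] -/
theorem diagonalLaw_zero_criticalFugacity :
    diagonalLaw Ω δ a b 0 SAW.criticalFugacity = SAW.law Ω δ a b :=
  SAW.tiltedLaw_zero_criticalFugacity _

/-- The dimer factor is at least `1` (every factor is `max 1 _`; an infinite support gives the
junk value `1`). [folklore] -/
theorem one_le_dimerFactor (H : SimpleGraph (Site 2)) (V : Set (Site 2)) :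
    1 ≤ dimerFactor H V := by
  unfold dimerFactor
  exact one_le_finprod' fun _ => le_max_left _ _

/-- The dimer factor is positive as a real number. [folklore] -/
theorem dimerFactor_cast_pos (H : SimpleGraph (Site 2)) (V : Set (Site 2)) :
    (0 : ℝ) < (dimerFactor H V : ℝ) := by
  exact_mod_cast (one_le_dimerFactor H V)

/-- The tilted weight atom of the diagonal family is `y^{|γ|} e^{sΦ(γ)}` (as an extended
nonnegative real). [folklore] -/
theorem ofReal_pow_mul_rpow (s y : ℝ) (γ : SAW.DomainSAW Ω δ a b) :
    ENNReal.ofReal (y ^ γ.length) * ENNReal.ofReal (Real.exp (diagonalDressing γ)) ^ s =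
      ENNReal.ofReal (diagonalWeight s y γ) := by
  rw [ENNReal.ofReal_rpow_of_pos (Real.exp_pos _), ← Real.exp_mul, diagonalWeight,
    ENNReal.ofReal_mul' (Real.exp_pos _).le, mul_comm (diagonalDressing γ) s]

/-- **`s = 1/2` is the discrepancy walk**: the diagonal law at `s = 1/2` and fugacity `x` is the
route's discrepancy law `∝ x^{|γ|} · e^{m(γ)/2} · pm⋆(A_δ ∖ γ)²` — the right-hand side is the
route's inlined `let L` of `Theses/SAWDeterminantalDiagonal.lean` with `m`, `pm`, `A` named
(`rwLoopMass`, `dimerFactor`, `blockArena`; definitionally equal to the inlined term). [folklore] -/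
theorem diagonalLaw_half_eq_discrepancyLaw (x : ℝ) :
    diagonalLaw Ω δ a b (1 / 2) x =
      ((Measure.sum (fun γ : SAW.DomainSAW Ω δ a b => ENNReal.ofReal (x ^ γ.length *
        Real.exp (rwLoopMass (discreteDomainGraph Ω δ) {v | v ∈ γ.walk.support} / 2) *
        ((dimerFactor (discreteDomainGraph Ω δ)
          (blockArena Ω δ \ {v | v ∈ γ.walk.support}) : ℕ) : ℝ) ^ 2) • Measure.dirac γ))
          Set.univ)⁻¹ •
      Measure.sum (fun γ : SAW.DomainSAW Ω δ a b => ENNReal.ofReal (x ^ γ.length *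
        Real.exp (rwLoopMass (discreteDomainGraph Ω δ) {v | v ∈ γ.walk.support} / 2) *
        ((dimerFactor (discreteDomainGraph Ω δ)
          (blockArena Ω δ \ {v | v ∈ γ.walk.support}) : ℕ) : ℝ) ^ 2) • Measure.dirac γ) := by
  have e4 : ∀ t : ℝ, (1 / 2 : ℝ) * (4 * t) = ((2 : ℕ) : ℝ) * t := fun t => by
    push_cast; ring
  have hw : ∀ γ : SAW.DomainSAW Ω δ a b,
      ENNReal.ofReal (x ^ γ.length) * ENNReal.ofReal (Real.exp (diagonalDressing γ)) ^ (1 / 2 : ℝ) =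
        ENNReal.ofReal (x ^ γ.length *
          Real.exp (rwLoopMass (discreteDomainGraph Ω δ) {v | v ∈ γ.walk.support} / 2) *
          ((dimerFactor (discreteDomainGraph Ω δ)
            (blockArena Ω δ \ {v | v ∈ γ.walk.support}) : ℕ) : ℝ) ^ 2) := by
    intro γ
    have hp := dimerFactor_cast_pos (discreteDomainGraph Ω δ)
      (blockArena Ω δ \ {v | v ∈ γ.walk.support})
    have h1 : Real.exp ((1 / 2 : ℝ) * diagonalDressing γ) =
        Real.exp (rwLoopMass (discreteDomainGraph Ω δ) {v | v ∈ γ.walk.support} / 2) *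
          ((dimerFactor (discreteDomainGraph Ω δ)
            (blockArena Ω δ \ {v | v ∈ γ.walk.support}) : ℕ) : ℝ) ^ 2 := by
      rw [diagonalDressing, mul_add, Real.exp_add, e4, Real.exp_nat_mul, Real.exp_log hp, one_div,
        inv_mul_eq_div]
    rw [ofReal_pow_mul_rpow, diagonalWeight, h1, mul_assoc]
  have hW : SAW.tiltedWeight (fun γ : SAW.DomainSAW Ω δ a b =>
      ENNReal.ofReal (Real.exp (diagonalDressing γ))) (1 / 2) x =
      Measure.sum (fun γ : SAW.DomainSAW Ω δ a b => ENNReal.ofReal (x ^ γ.length *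
        Real.exp (rwLoopMass (discreteDomainGraph Ω δ) {v | v ∈ γ.walk.support} / 2) *
        ((dimerFactor (discreteDomainGraph Ω δ)
          (blockArena Ω δ \ {v | v ∈ γ.walk.support}) : ℕ) : ℝ) ^ 2) • Measure.dirac γ) := by
    unfold SAW.tiltedWeight
    congr 1
    funext γ
    congr 1
    exact hw γ
  unfold diagonalLaw SAW.tiltedLaw
  rw [hW]

/-! ### The finite walk space: evaluation of integrals and covariances -/

section Finite

/-- The vertices of a walk of `Ω_δ` are its starting point or sites of `Ω_δ`. [folklore] -/
-- adapted from Summits/CriticalPhenomena/SAWScalingLimit/Theorems/SAWChargeContinuationVitaliTransport.lean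
theorem mem_support_walk {u w : Site 2} (p : (discreteDomainGraph Ω δ).Walk u w) :
    ∀ z ∈ p.support, z = u ∨ z ∈ meshDomain Ω δ := by
  induction p with
  | nil =>
    intro z hz
    rw [SimpleGraph.Walk.support_nil, List.mem_singleton] at hz
    exact Or.inl hz
  | cons h p ih =>
    intro z hz
    rw [SimpleGraph.Walk.support_cons, List.mem_cons] at hz
    rcases hz with rfl | hz
    · exact Or.inl rfl
    · rcases ih z hz with rfl | hz'
      · exact Or.inr (discreteDomainGraph_adj_iff.1 h).2.2
      · exact Or.inr hz'

/-- **Finiteness of the walk space**: for a bounded domain and a positive mesh there are finitely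
many SAWs of `Ω_δ` between two given sites (their supports are duplicate-free lists over the
finite set `{u} ∪ Ω_δ`). [folklore] -/
-- adapted from Summits/CriticalPhenomena/SAWScalingLimit/Theorems/SAWChargeContinuationVitaliTransport.lean
theorem finite_domainSAW (hΩ : Bornology.IsBounded Ω) (hδ : 0 < δ) (u w : Site 2) :
    Finite (SAW.DomainSAW Ω δ u w) := by
  set S : Set (Site 2) := insert u (meshDomain Ω δ) with hSdef
  have hfin : S.Finite := (meshDomain_finite hΩ hδ).insert u
  haveI : Fintype ↥S := hfin.fintype
  have hsupp : ∀ (γ : SAW.DomainSAW Ω δ u w), ∀ z ∈ γ.walk.support, z ∈ S := by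
    intro γ z hz
    rcases mem_support_walk γ.walk z hz with rfl | h
    · exact Set.mem_insert _ _
    · exact Set.mem_insert_of_mem _ h
  let f : SAW.DomainSAW Ω δ u w → {l : List ↥S // l.length ≤ Fintype.card ↥S} :=
    fun γ => ⟨γ.walk.support.pmap (fun z hz => ⟨z, hz⟩) (hsupp γ), by
      rw [List.length_pmap]
      have hnd : (γ.walk.support.pmap (fun z hz => (⟨z, hz⟩ : ↥S)) (hsupp γ)).Nodup := by
        refine List.Nodup.pmap ?_ γ.isPath.support_nodup
        intro a _ b _ h
        exact congrArg Subtype.val h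
      have := hnd.length_le_card
      rwa [List.length_pmap] at this⟩
  haveI : Finite {l : List ↥S // l.length ≤ Fintype.card ↥S} :=
    (List.finite_length_le _ _).to_subtype
  refine Finite.of_injective f fun γ γ' h => ?_
  apply SAW.DomainSAW.walk_injective
  apply SimpleGraph.Walk.support_injective
  have h' :=
    congrArg (fun l : {l : List ↥S // l.length ≤ Fintype.card ↥S} => l.1.map Subtype.val) h
  simpa [f, List.map_pmap] using h'

/-- The diagonal weight is positive for a positive fugacity. [folklore] -/
theorem diagonalWeight_pos {s y : ℝ} (hy : 0 < y) (γ : SAW.DomainSAW Ω δ a b) :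
    0 < diagonalWeight s y γ :=
  mul_pos (pow_pos hy _) (Real.exp_pos _)

/-- The diagonal law is the zero measure or a probability measure. [folklore] -/
theorem diagonalLaw_eq_zero_or_isProbabilityMeasure (s y : ℝ) :
    diagonalLaw Ω δ a b s y = 0 ∨ IsProbabilityMeasure (diagonalLaw Ω δ a b s y) :=
  SAW.tiltedLaw_eq_zero_or_isProbabilityMeasure _ _ _

/-- The diagonal law is a finite measure. [folklore] -/
instance isFiniteMeasure_diagonalLaw (s y : ℝ) : IsFiniteMeasure (diagonalLaw Ω δ a b s y) := by
  rcases diagonalLaw_eq_zero_or_isProbabilityMeasure (Ω := Ω) (δ := δ) (a := a) (b := b) s y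
    with h | h
  · rw [h]; infer_instance
  · infer_instance

variable [Fintype (SAW.DomainSAW Ω δ a b)]

/-- **Gibbs average** of `F` under the weights `w` on a finite type:
`(∑ w·F) / (∑ w)` (junk `0` for total weight `0`, e.g. on an empty type). [folklore] -/
def gibbsAverage {ι : Type*} [Fintype ι] (w : ι → ℝ) (F : ι → ℝ) : ℝ :=
  (∑ i, w i * F i) / ∑ i, w i

/-- The total tilted weight of the diagonal family is `∑_γ y^{|γ|} e^{sΦ(γ)}` (finite type,
positive fugacity). [folklore] -/
theorem tiltedWeight_univ_eq {s y : ℝ} (hy : 0 < y) :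
    SAW.tiltedWeight (fun γ : SAW.DomainSAW Ω δ a b => ENNReal.ofReal (Real.exp (diagonalDressing γ)))
        s y Set.univ = ENNReal.ofReal (∑ γ : SAW.DomainSAW Ω δ a b, diagonalWeight s y γ) := by
  rw [SAW.tiltedWeight_apply, tsum_fintype, ENNReal.ofReal_sum_of_nonneg
    (fun γ _ => (diagonalWeight_pos hy γ).le)]
  refine Finset.sum_congr rfl fun γ _ => ?_
  rw [Set.indicator_of_mem (Set.mem_univ _), ofReal_pow_mul_rpow]

/-- **The atoms of the diagonal law**: `P_{s,y}{γ} = w_{s,y}(γ) / ∑ w_{s,y}` (real form; both sides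
`0` on an empty walk space). [folklore] -/
theorem real_diagonalLaw_singleton {s y : ℝ} (hy : 0 < y) (γ : SAW.DomainSAW Ω δ a b) :
    (diagonalLaw Ω δ a b s y).real {γ} =
      diagonalWeight s y γ / ∑ γ' : SAW.DomainSAW Ω δ a b, diagonalWeight s y γ' := by
  rw [measureReal_def, diagonalLaw, SAW.tiltedLaw, Measure.smul_apply,
    SAW.tiltedWeight_singleton, tiltedWeight_univ_eq hy]
  rw [ofReal_pow_mul_rpow, smul_eq_mul, ENNReal.toReal_mul,
    ENNReal.toReal_inv, ENNReal.toReal_ofReal (diagonalWeight_pos hy γ).le,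
    ENNReal.toReal_ofReal (Finset.sum_nonneg fun γ' _ => (diagonalWeight_pos hy γ').le),
    div_eq_inv_mul]

/-- **Integrals against the diagonal law are Gibbs averages**:
`∫ F dP_{s,y} = (∑_γ w_{s,y}(γ) F(γ)) / ∑_γ w_{s,y}(γ)`. [folklore] -/
theorem integral_diagonalLaw {s y : ℝ} (hy : 0 < y) (F : SAW.DomainSAW Ω δ a b → ℝ) :
    ∫ γ, F γ ∂(diagonalLaw Ω δ a b s y) = gibbsAverage (diagonalWeight s y) F := by
  rw [integral_fintype (Integrable.of_finite), gibbsAverage, Finset.sum_div]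
  refine Finset.sum_congr rfl fun γ _ => ?_
  rw [real_diagonalLaw_singleton hy, smul_eq_mul, div_mul_eq_mul_div]

/-- The sum of the diagonal weights over a nonempty walk space is nonzero. [folklore] -/
theorem sum_diagonalWeight_ne_zero {s y : ℝ} (hy : 0 < y) [Nonempty (SAW.DomainSAW Ω δ a b)] :
    (∑ γ : SAW.DomainSAW Ω δ a b, diagonalWeight s y γ) ≠ 0 :=
  (Finset.sum_pos (fun γ _ => diagonalWeight_pos hy γ) Finset.univ_nonempty).ne'

/-- **Gibbs covariance identity** on a finite type with nonzero total weight: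
`E[(F − E F)(G − E G)] = E[FG] − E[F] E[G]`. [folklore] -/
theorem gibbsAverage_centered_mul {ι : Type*} [Fintype ι] (w F G : ι → ℝ) (hZ : ∑ i, w i ≠ 0) :
    gibbsAverage w (fun i => (F i - gibbsAverage w F) * (G i - gibbsAverage w G)) =
      gibbsAverage w (fun i => F i * G i) - gibbsAverage w F * gibbsAverage w G := by
  unfold gibbsAverage
  have hsum : ∑ i, w i * ((F i - (∑ j, w j * F j) / ∑ j, w j) *
      (G i - (∑ j, w j * G j) / ∑ j, w j)) =
        (∑ i, w i * (F i * G i)) - ((∑ j, w j * G j) / ∑ j, w j) * (∑ i, w i * F i)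
          - ((∑ j, w j * F j) / ∑ j, w j) * (∑ i, w i * G i)
          + ((∑ j, w j * F j) / ∑ j, w j) * ((∑ j, w j * G j) / ∑ j, w j) * ∑ i, w i := by
    rw [Finset.mul_sum, Finset.mul_sum, Finset.mul_sum, ← Finset.sum_sub_distrib,
      ← Finset.sum_sub_distrib, ← Finset.sum_add_distrib]
    exact Finset.sum_congr rfl fun i _ => by ring
  rw [hsum]
  field_simp
  ring

/-- **Covariances under the diagonal law are Gibbs covariances**:
`Cov_{s,y}(F, G) = E[FG] − E[F]E[G]` with `E` the Gibbs average (both sides `0` on an empty walk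
space). [folklore] -/
theorem covariance_diagonalLaw {s y : ℝ} (hy : 0 < y) (F G : SAW.DomainSAW Ω δ a b → ℝ) :
    ProbabilityTheory.covariance F G (diagonalLaw Ω δ a b s y) =
      gibbsAverage (diagonalWeight s y) (fun γ => F γ * G γ) -
        gibbsAverage (diagonalWeight s y) F * gibbsAverage (diagonalWeight s y) G := by
  rw [ProbabilityTheory.covariance, integral_diagonalLaw hy, integral_diagonalLaw hy,
    integral_diagonalLaw hy]
  rcases isEmpty_or_nonempty (SAW.DomainSAW Ω δ a b) with hE | hN
  · simp [gibbsAverage]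
  · exact gibbsAverage_centered_mul _ F G (sum_diagonalWeight_ne_zero hy)

end Finite

end Literature.Probability.RandomPlanarGeometry.SAW
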